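import Summits.NavierStokesRegularity.FluidComputer.CascadeWitnessAnatomy
import Summits.NavierStokesRegularity.FluidComputer.PartialRegularityFace
import Summits.NavierStokesRegularity.FluidComputer.PressureFace
import Summits.NavierStokesRegularity.FluidComputer.BesovFace
import Summits.NavierStokesRegularity.FluidComputer.StrainFace
import Summits.NavierStokesRegularity.FluidComputer.SymmetryFace
import HarnessLib

/-!
# Fluid computer — the partial-regularity / pressure / Besov / strain / symmetry faces READ ON THE INTERFACE

HONEST FRAMING (cell `pub-fluidc`, verbatim): *low prior, high value-of-information experiment on Tao's
machine paradigm; NOT a claim that NS blows up.* An implication from the cell's (uninhabited, as far as anyone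
knows) interface structure `CascadeWitness`; nothing here is evidence of blow-up. Companion of
`CascadeWitnessFloor`, `CascadeWitnessClock`, `CriticalFace.critical_face_of_cascadeWitness` and
`CascadeWitnessAnatomy`: every `W : CascadeWitness` yields (via `x5a_of_cascadeWitness'`) `ν > 0`, `T > 0` and a
maximal smooth Leray–Hopf solution `(u, p)` of the unforced Navier–Stokes system on `ℝ³ × [0, T)`, and therefore

* `partial_regularity_face_of_cascadeWitness` — its BLOW-UP SET `{x | IsBackwardSingularPoint u (T, x)}` is nonempty,
  compact, `μH¹`-null, and meets every straight line in a set of linear measure zero (L37,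
  `PartialRegularityFace.partial_regularity_face`);
* `pressure_face_of_cascadeWitness` — its normalised pressure has NO FLOOR on any terminal window (L38,
  `PressureFace.pressure_face`);
* `besov_face_of_cascadeWitness` — its critical Besov norms `Ḃ^{-1+3/r}_{r,q}` (`3 < r, q < ∞`) of every
  representing family are unbounded on every terminal window (L39, `BesovFace.besov_face`);
* `strain_face_of_cascadeWitness` — the Prodi–Serrin integrals of every majorant of its middle strain eigenvalue
  diverge on every terminal window (L41, `StrainFace.strain_face`);
* `symmetry_face_of_cascadeWitness` — IF its slices are axisymmetric, it is not Type I and `r|u|` is unbounded on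
  every terminal window (L40, `SymmetryFace.symmetry_face`).

0 sorry; no new definitions, no named facts.

## References

* L. Caffarelli, R. Kohn, L. Nirenberg, Comm. Pure Appl. Math. 35 (1982) 771–831, Theorem B. [CKN1982]
* G. Seregin, V. Šverák, Arch. Ration. Mech. Anal. 163 (2002) 65–86, Thm. 2.2. [SereginSverak2002]
* I. Gallagher, G. Koch, F. Planchon, Comm. Math. Phys. 343 (2016) 39–82, Thm. 1. [GKP2016]
* E. Miller, Arch. Ration. Mech. Anal. 237 (2020) 1237–1263, Thm. 1.1. [Miller2019]
* G. Koch, N. Nadirashvili, G. Seregin, V. Šverák, Acta Math. 203 (2009) 83–105, Thms. 6.1–6.2.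
  [KochNadirashviliSereginSverak2009]
-/

noncomputable section

open MeasureTheory Set Function Filter Topology Metric
open scoped ENNReal NNReal SchwartzMap
open Literature.Analysis.FluidPDE Literature.Analysis.FunctionSpaces Literature.Analysis.FluidPDE.FluidComputer
open Summit.NavierStokesRegularity.NavierStokesRegularity.Theorems.FluidComputer (x5a_of_cascadeWitness')
open Summit.NavierStokesRegularity.FluidComputer.PartialRegularityFace
open Summit.NavierStokesRegularity.FluidComputer.PressureFace
open Summit.NavierStokesRegularity.FluidComputer.BesovFace
open Summit.NavierStokesRegularity.FluidComputer.StrainFace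
open Summit.NavierStokesRegularity.FluidComputer.SymmetryFace

namespace Summit.NavierStokesRegularity.FluidComputer.CascadeWitnessProfile

/-- **Every cascade witness has a nonempty compact `μH¹`-null blow-up set without singular filaments** (L37 on
the interface). [cite: CKN1982, Theorem B] -/
theorem partial_regularity_face_of_cascadeWitness (W : CascadeWitness) :
    ∃ ν : ℝ, 0 < ν ∧ ∃ T : ℝ, 0 < T ∧
      ∃ (u : ℝ → EuclideanSpace ℝ (Fin 3) → EuclideanSpace ℝ (Fin 3))
        (p : ℝ → EuclideanSpace ℝ (Fin 3) → ℝ),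
        IsMaximalSmoothSolution ν 0 u p T ∧ IsLerayHopfOn T ν 0 (u 0) u ∧
        {x | IsBackwardSingularPoint u ((T : ℝ), x)}.Nonempty ∧
        IsCompact {x | IsBackwardSingularPoint u ((T : ℝ), x)} ∧
        μH[1] {x | IsBackwardSingularPoint u ((T : ℝ), x)} = 0 ∧
        ∀ (a v : EuclideanSpace ℝ (Fin 3)), ‖v‖ = 1 →
          volume {s : ℝ | IsBackwardSingularPoint u ((T : ℝ), a + s • v)} = 0 := by
  obtain ⟨ν, hν, T, hT, u, p, hmax, hLH, -⟩ := x5a_of_cascadeWitness' W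
  exact ⟨ν, hν, T, hT, u, p, hmax, hLH, partial_regularity_face hν hT hmax hLH⟩

/-- **The normalised pressure of every cascade witness has no floor on any terminal window** (L38 on the
interface). [cite: SereginSverak2002, Thm. 2.2 (p. 70), case p ≥ −g] -/
theorem pressure_face_of_cascadeWitness (W : CascadeWitness) :
    ∃ ν : ℝ, 0 < ν ∧ ∃ T : ℝ, 0 < T ∧
      ∃ (u : ℝ → EuclideanSpace ℝ (Fin 3) → EuclideanSpace ℝ (Fin 3))
        (p : ℝ → EuclideanSpace ℝ (Fin 3) → ℝ),
        IsMaximalSmoothSolution ν 0 u p T ∧ IsLerayHopfOn T ν 0 (u 0) u ∧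
        ∀ K : ℝ, ∀ t₀ ∈ Ico 0 T, ∃ t ∈ Ioo t₀ T, ∃ x : EuclideanSpace ℝ (Fin 3),
          normalisedPressure (u t) x < -K := by
  obtain ⟨ν, hν, T, hT, u, p, hmax, hLH, -⟩ := x5a_of_cascadeWitness' W
  exact ⟨ν, hν, T, hT, u, p, hmax, hLH, pressure_face hν hT hmax hLH⟩

/-- **The critical Besov norms of every cascade witness blow up on every terminal window** (L39 on the interface):
representing families exist, and for each of them and all `3 < r, q < ∞`, `t₀ < T`:
`sup_{t ∈ [t₀,T)} ‖U t‖_{Ḃ^{-1+3/r}_{r,q}} = ∞`. [cite: GKP2016, Thm. 1] -/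
theorem besov_face_of_cascadeWitness (W : CascadeWitness) :
    ∃ ν : ℝ, 0 < ν ∧ ∃ T : ℝ, 0 < T ∧
      ∃ (u : ℝ → EuclideanSpace ℝ (Fin 3) → EuclideanSpace ℝ (Fin 3))
        (p : ℝ → EuclideanSpace ℝ (Fin 3) → ℝ),
        IsMaximalSmoothSolution ν 0 u p T ∧ IsLerayHopfOn T ν 0 (u 0) u ∧
        (∃ U : ℝ → 𝓢'(EuclideanSpace ℝ (Fin 3), EuclideanSpace ℂ (Fin 3)),
            ∀ t ∈ Ico 0 T, IsDistributionOf (u t) (U t)) ∧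
        ∀ (U : ℝ → 𝓢'(EuclideanSpace ℝ (Fin 3), EuclideanSpace ℂ (Fin 3))),
          (∀ t ∈ Ico 0 T, IsDistributionOf (u t) (U t)) →
          ∀ (r q : ℝ≥0∞) [Fact (1 ≤ r)], 3 < r → r < ⊤ → 3 < q → q < ⊤ →
            ∀ t₀ ∈ Ico 0 T, (⨆ t ∈ Ico t₀ T, eHomBesovNorm (-1 + 3 / r.toReal) r q (U t)) = ⊤ := by
  obtain ⟨ν, hν, T, hT, u, p, hmax, hLH, -⟩ := x5a_of_cascadeWitness' W
  exact ⟨ν, hν, T, hT, u, p, hmax, hLH, besov_face hν hT hmax hLH⟩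

/-- **The middle strain eigenvalue of every cascade witness has divergent Prodi–Serrin integrals on every terminal
window** (L41 on the interface): for every `3/2 < q` and every nonnegative Courant–Fischer majorant `m` of the
middle eigenvalue of the strain, `∫_{(t₀,T)} (∫ m^q)^{2/(2q−3)} = ∞`. [cite: Miller2019, Thm 1.1] -/
theorem strain_face_of_cascadeWitness (W : CascadeWitness) :
    ∃ ν : ℝ, 0 < ν ∧ ∃ T : ℝ, 0 < T ∧
      ∃ (u : ℝ → EuclideanSpace ℝ (Fin 3) → EuclideanSpace ℝ (Fin 3))
        (p : ℝ → EuclideanSpace ℝ (Fin 3) → ℝ),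
        IsMaximalSmoothSolution ν 0 u p T ∧ IsLerayHopfOn T ν 0 (u 0) u ∧
        ∀ q : ℝ, 3 / 2 < q → ∀ m : ℝ → EuclideanSpace ℝ (Fin 3) → ℝ, (∀ t x, 0 ≤ m t x) →
          (∀ t ∈ Ico 0 T, ∀ x, ∃ v w : EuclideanSpace ℝ (Fin 3), ‖v‖ = 1 ∧ ‖w‖ = 1 ∧
            inner ℝ v w = 0 ∧ ∀ α β : ℝ,
              inner ℝ (fderiv ℝ (u t) x (α • v + β • w)) (α • v + β • w) ≤ m t x * (α ^ 2 + β ^ 2)) →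
          ∀ t₀ ∈ Ico 0 T,
            ∫⁻ t in Ioo t₀ T, (∫⁻ x, ENNReal.ofReal (m t x) ^ q) ^ (2 / (2 * q - 3)) = ⊤ := by
  obtain ⟨ν, hν, T, hT, u, p, hmax, hLH, -⟩ := x5a_of_cascadeWitness' W
  exact ⟨ν, hν, T, hT, u, p, hmax, hLH, strain_face hν hmax hLH⟩

/-- **An axisymmetric cascade witness is Type II and breaks the `C/r` bound** (L40 on the interface): if the
slices of the solution it yields are axisymmetric, then it is not Type I at `T` and `r|u|` exceeds every constant
on every terminal window. [cite: KochNadirashviliSereginSverak2009, Thms 6.1–6.2] -/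
theorem symmetry_face_of_cascadeWitness (W : CascadeWitness) :
    ∃ ν : ℝ, 0 < ν ∧ ∃ T : ℝ, 0 < T ∧
      ∃ (u : ℝ → EuclideanSpace ℝ (Fin 3) → EuclideanSpace ℝ (Fin 3))
        (p : ℝ → EuclideanSpace ℝ (Fin 3) → ℝ),
        IsMaximalSmoothSolution ν 0 u p T ∧ IsLerayHopfOn T ν 0 (u 0) u ∧
        ((∀ t ∈ Ico 0 T, IsAxisymmetric (u t)) →
          ¬ IsTypeIBlowup u T ∧
            ∀ C : ℝ, ∀ t₀ ∈ Ico 0 T, ∃ t ∈ Ico t₀ T, ∃ x : EuclideanSpace ℝ (Fin 3),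
              C < cylRadius x * ‖u t x‖) := by
  obtain ⟨ν, hν, T, hT, u, p, hmax, hLH, -⟩ := x5a_of_cascadeWitness' W
  exact ⟨ν, hν, T, hT, u, p, hmax, hLH, fun haxi => symmetry_face hν hT hmax hLH haxi⟩

end Summit.NavierStokesRegularity.FluidComputer.CascadeWitnessProfile

end
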